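import Mathlib
import Summits.Ventures.PercRepro2.SepSplitFrozen

/-!
# Gluing at a general separator, XV: two pointwise deaths — the `o`–`a₃` coincidence and the
`pd`-dead triples (blind cell PercRepro2, mine-2 g49, 2026-08-29; `conjectures/MINE-2.md` M2-102 (3))

Two mechanisms found by the always-zero census of M2-102, both POINTWISE in the kernel `KB`
itself (every permuted root count vanishes, not only the orbit sum).  (1) THE `o`–`a₃`
COINCIDENCE: `KB` vanishes on every state triple in which `o` and `a₃` have the same status in each
copy, `(L_o, H_o) = (L₃, H₃)` (`KB_eq_zero_of_coincide`: under the coincidence `pd · u_o = 0` and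
`pd · σ_o = 0`, and the eight terms pair off — a `decide` over the 32,768 triples).  With `o` and
`a₃` both behind the separator and EQUAL COLUMNS in the far datum (`EqCols03`: the same
connections to the separator vertices and to the marks), their glued statuses coincide for every
root datum (`gluedS_coincide_of_eqCols03`), so every root count of a triple of such data vanishes
(`rootKS_eq_zero_of_coincide03`, `orbitRootS_eq_zero_of_coincide03`).  (2) `pd`-DEAD: `KB x y z`
vanishes as soon as `pd x = pd y = 0` (`KB_eq_zero_of_pdB`: six terms carry `pd x`, the other two
`pd y`); a far datum joining `a₃` directly to a far root puts `a₃` into that root's glued cluster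
(`gluedS_pdB_of_joined3`), so if every far datum of the triple does, every permuted root count
vanishes (`orbitRootS_eq_zero_of_pdDead`).  Own work; standard axioms.
-/

namespace Summit.Ventures.PercRepro2

open UnionCluster

namespace CovForm

namespace RootBridge

open OneTyped TypedA3 Untouched TypedFactor Separated

/-! ## The two pointwise identities on states -/

section Pointwise

/-- **The `o`–`a₃` coincidence kills the kernel pointwise**: on the 32,768 state triples with
`(L_o, H_o) = (L₃, H₃)` in each copy, `KB = 0`. -/
theorem KB_eq_zero_of_coincide_bits (q Lo Ho Lb Hb q' Lo' Ho' Lb' Hb' q'' Lo'' Ho'' Lb'' Hb'' : Bool) :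
    KB (q, Lo, Ho, Lb, Hb, Lo, Ho) (q', Lo', Ho', Lb', Hb', Lo', Ho')
      (q'', Lo'', Ho'', Lb'', Hb'', Lo'', Ho'') = 0 := by
  revert q Lo Ho Lb Hb q' Lo' Ho' Lb' Hb' q'' Lo'' Ho'' Lb'' Hb''
  decide +kernel

/-- The coincidence on states. -/
theorem KB_eq_zero_of_coincide (x y z : St) (hx : x.L3 = x.Lo ∧ x.H3 = x.Ho)
    (hy : y.L3 = y.Lo ∧ y.H3 = y.Ho) (hz : z.L3 = z.Lo ∧ z.H3 = z.Ho) : KB x y z = 0 := by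
  obtain ⟨q, Lo, Ho, Lb, Hb, L3, H3⟩ := x
  obtain ⟨q', Lo', Ho', Lb', Hb', L3', H3'⟩ := y
  obtain ⟨q'', Lo'', Ho'', Lb'', Hb'', L3'', H3''⟩ := z
  simp only [St.L3, St.Lo, St.H3, St.Ho] at hx hy hz
  obtain ⟨rfl, rfl⟩ := hx
  obtain ⟨rfl, rfl⟩ := hy
  obtain ⟨rfl, rfl⟩ := hz
  exact KB_eq_zero_of_coincide_bits _ _ _ _ _ _ _ _ _ _ _ _ _ _ _

/-- `pd` vanishes on a state with `a₃` in a root cluster. -/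
lemma pdB_eq_zero_of_L3_or_H3 (s : St) (h : s.L3 = true ∨ s.H3 = true) : pdB s = 0 := by
  unfold pdB
  rcases h with h | h <;> simp [h]

/-- **Two `pd`-dead copies kill the kernel pointwise.** -/
lemma KB_eq_zero_of_pdB (x y z : St) (hx : pdB x = 0) (hy : pdB y = 0) : KB x y z = 0 := by
  unfold KB
  rw [hx, hy]
  ring

end Pointwise

/-! ## Equal columns of `o` and `a₃` in the far datum -/

section Cols

open Classical

variable {ι : Type*}

/-- The far datum gives `o` and `a₃` the same connections to the separator vertices and to the
marks. -/
def EqCols03 (p : SideData ι) : Prop :=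
  (∀ j, p.2.1 j 0 = p.2.1 j 3) ∧ (∀ k, p.1 k 0 = p.1 k 3)

/-- With `o` and `a₃` both behind the separator and equal columns, a mark reaches `o` iff it
reaches `a₃`. -/
lemma connS_0_iff_3 (h p : SideData ι) (side : Fin 5 → Bool) (h0 : side 0 = true)
    (h3 : side 3 = true) (hc : EqCols03 p) (k : Fin 5) :
    connS h p side k 0 ↔ connS h p side k 3 := by
  unfold connS
  simp only [h0, h3, ↓reduceIte]
  by_cases hk : side k = true
  · simp only [hk, ↓reduceIte, hc.2 k, hc.1]
  · have hk' : side k = false := by simpa using hk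
    simp only [hk', Bool.false_eq_true, ↓reduceIte, hc.1]

/-- The glued state of such a datum has coinciding `o`- and `a₃`-statuses. -/
lemma gluedS_coincide_of_eqCols03 (h p : SideData ι) (side : Fin 5 → Bool) (h0 : side 0 = true)
    (h3 : side 3 = true) (hc : EqCols03 p) :
    (gluedS h p side).L3 = (gluedS h p side).Lo ∧ (gluedS h p side).H3 = (gluedS h p side).Ho := by
  unfold gluedS St.L3 St.Lo St.H3 St.Ho
  simp only
  exact ⟨decide_eq_decide.mpr (connS_0_iff_3 h p side h0 h3 hc 1).symm,
    decide_eq_decide.mpr (connS_0_iff_3 h p side h0 h3 hc 2).symm⟩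

/-- A far datum joining `a₃` directly to a far root puts `a₃` into that root's glued cluster:
`pd` vanishes on the glued state. -/
lemma gluedS_pdB_of_joined3 (h p : SideData ι) (side : Fin 5 → Bool) (h3 : side 3 = true)
    (hp : (side 1 = true ∧ p.1 1 3 = true) ∨ (side 2 = true ∧ p.1 2 3 = true)) :
    pdB (gluedS h p side) = 0 := by
  refine pdB_eq_zero_of_L3_or_H3 _ ?_
  unfold gluedS St.L3 St.H3
  simp only [decide_eq_true_eq]
  rcases hp with ⟨h1, hp⟩ | ⟨h2, hp⟩
  · left
    unfold connS
    rw [if_pos h1, if_pos h3]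
    exact Or.inl hp
  · right
    unfold connS
    rw [if_pos h2, if_pos h3]
    exact Or.inl hp

end Cols

/-! ## The vanishing theorems -/

section Vanish

open Classical

variable {V : Type*} {E : Type*} {ι : Type*} [Fintype E] [DecidableEq E] {R : Type*} [Field R]
variable (ends : E → Sym2 V) (mk : Fin 5 → V) (σ : ι → V)

omit [Fintype E] [DecidableEq E] in
/-- A root-side kernel of a triple of equal-column data vanishes pointwise. -/
lemma rootKS_eq_zero_of_coincide03 (side : Fin 5 → Bool) (h0 : side 0 = true) (h3 : side 3 = true)
    (VH : Set V) (q : Pat3S ι) (hq : EqCols03 q.1 ∧ EqCols03 q.2.1 ∧ EqCols03 q.2.2)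
    (x y w : Config E) : rootKS ends mk σ side VH q x y w = (0 : R) := by
  unfold rootKS
  rw [KB_eq_zero_of_coincide _ _ _ (gluedS_coincide_of_eqCols03 _ _ side h0 h3 hq.1)
    (gluedS_coincide_of_eqCols03 _ _ side h0 h3 hq.2.1)
    (gluedS_coincide_of_eqCols03 _ _ side h0 h3 hq.2.2)]
  simp

/-- The root count of a triple of equal-column data vanishes. -/
lemma typedCount_rootKS_eq_zero_of_coincide03 (side : Fin 5 → Bool) (h0 : side 0 = true)
    (h3 : side 3 = true) (VH : Set V) (B : Finset E) (z : Config E) (τ : E → ℕ) (q : Pat3S ι)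
    (hq : EqCols03 q.1 ∧ EqCols03 q.2.1 ∧ EqCols03 q.2.2) :
    typedCount B z τ (rootKS ends mk σ side VH q : Config E → Config E → Config E → R) = 0 := by
  rw [← typedCount_zero_kernel B z τ]
  exact typedCount_congr' _ _ _ _ _ fun x y w =>
    rootKS_eq_zero_of_coincide03 ends mk σ side h0 h3 VH q hq x y w

/-- **The `o`–`a₃` coincidence ⟹ the orbit sum is zero** (every permuted root count vanishes). -/
theorem orbitRootS_eq_zero_of_coincide03 (side : Fin 5 → Bool) (h0 : side 0 = true)
    (h3 : side 3 = true) (VH : Set V) (B : Finset E) (z : Config E) (τ : E → ℕ) (p : Pat3S ι)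
    (hp : EqCols03 p.1 ∧ EqCols03 p.2.1 ∧ EqCols03 p.2.2) :
    orbitRootS ends mk σ side VH B z τ p = (0 : R) := by
  obtain ⟨c1, c2, c3⟩ := hp
  unfold orbitRootS orbitSumG
  dsimp only
  rw [typedCount_rootKS_eq_zero_of_coincide03 ends mk σ side h0 h3 VH B z τ p ⟨c1, c2, c3⟩,
    typedCount_rootKS_eq_zero_of_coincide03 ends mk σ side h0 h3 VH B z τ (p.2.1, p.1, p.2.2)
      ⟨c2, c1, c3⟩,
    typedCount_rootKS_eq_zero_of_coincide03 ends mk σ side h0 h3 VH B z τ (p.1, p.2.2, p.2.1)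
      ⟨c1, c3, c2⟩,
    typedCount_rootKS_eq_zero_of_coincide03 ends mk σ side h0 h3 VH B z τ (p.2.2, p.2.1, p.1)
      ⟨c3, c2, c1⟩,
    typedCount_rootKS_eq_zero_of_coincide03 ends mk σ side h0 h3 VH B z τ (p.2.1, p.2.2, p.1)
      ⟨c2, c3, c1⟩,
    typedCount_rootKS_eq_zero_of_coincide03 ends mk σ side h0 h3 VH B z τ (p.2.2, p.1, p.2.1)
      ⟨c3, c1, c2⟩]
  ring

/-- A far datum joins `a₃` directly to a far root. -/
def Joins3 (side : Fin 5 → Bool) (p : SideData ι) : Prop :=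
  (side 1 = true ∧ p.1 1 3 = true) ∨ (side 2 = true ∧ p.1 2 3 = true)

omit [Fintype E] [DecidableEq E] in
/-- A root-side kernel of a triple whose first two data join `a₃` to a far root vanishes
pointwise. -/
lemma rootKS_eq_zero_of_joins3 (side : Fin 5 → Bool) (h3 : side 3 = true) (VH : Set V)
    (q : Pat3S ι) (hq : Joins3 side q.1 ∧ Joins3 side q.2.1) (x y w : Config E) :
    rootKS ends mk σ side VH q x y w = (0 : R) := by
  unfold rootKS
  rw [KB_eq_zero_of_pdB _ _ _ (gluedS_pdB_of_joined3 _ _ side h3 hq.1)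
    (gluedS_pdB_of_joined3 _ _ side h3 hq.2)]
  simp

/-- The root count of such a triple vanishes. -/
lemma typedCount_rootKS_eq_zero_of_joins3 (side : Fin 5 → Bool) (h3 : side 3 = true) (VH : Set V)
    (B : Finset E) (z : Config E) (τ : E → ℕ) (q : Pat3S ι)
    (hq : Joins3 side q.1 ∧ Joins3 side q.2.1) :
    typedCount B z τ (rootKS ends mk σ side VH q : Config E → Config E → Config E → R) = 0 := by
  rw [← typedCount_zero_kernel B z τ]
  exact typedCount_congr' _ _ _ _ _ fun x y w =>
    rootKS_eq_zero_of_joins3 ends mk σ side h3 VH q hq x y w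

/-- **`pd`-dead ⟹ the orbit sum is zero**: every far datum of the triple joins `a₃` directly to a
far root. -/
theorem orbitRootS_eq_zero_of_pdDead (side : Fin 5 → Bool) (h3 : side 3 = true) (VH : Set V)
    (B : Finset E) (z : Config E) (τ : E → ℕ) (p : Pat3S ι)
    (hp : Joins3 side p.1 ∧ Joins3 side p.2.1 ∧ Joins3 side p.2.2) :
    orbitRootS ends mk σ side VH B z τ p = (0 : R) := by
  obtain ⟨c1, c2, c3⟩ := hp
  unfold orbitRootS orbitSumG
  dsimp only
  rw [typedCount_rootKS_eq_zero_of_joins3 ends mk σ side h3 VH B z τ p ⟨c1, c2⟩,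
    typedCount_rootKS_eq_zero_of_joins3 ends mk σ side h3 VH B z τ (p.2.1, p.1, p.2.2) ⟨c2, c1⟩,
    typedCount_rootKS_eq_zero_of_joins3 ends mk σ side h3 VH B z τ (p.1, p.2.2, p.2.1) ⟨c1, c3⟩,
    typedCount_rootKS_eq_zero_of_joins3 ends mk σ side h3 VH B z τ (p.2.2, p.2.1, p.1) ⟨c3, c2⟩,
    typedCount_rootKS_eq_zero_of_joins3 ends mk σ side h3 VH B z τ (p.2.1, p.2.2, p.1) ⟨c2, c3⟩,
    typedCount_rootKS_eq_zero_of_joins3 ends mk σ side h3 VH B z τ (p.2.2, p.1, p.2.1) ⟨c3, c1⟩]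
  ring

end Vanish

end RootBridge

end CovForm

end Summit.Ventures.PercRepro2
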